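import Literature.AnabelianGeometry.EtaleTheta.GalSectThm110iiiCuspPairTransport
import HarnessLib

/-!
# [EtTh] Thm. 1.10 (iii) — the input (Δ) `Γ(Δ^tp_{Cα}) = Δ^tp_{Cβ}` REDUCED to the X-level `γ_X(Δ^tp_{Xα}) = Δ^tp_{Xβ}`
# and «`G_K` has no element of order 2» (proof-only)

Mochizuki, *The étale theta function …* [EtTh], Publ. RIMS **45** (2009), Thm. 1.10 (iii) p.256
[cite: MochizukiEtTh2009, Thm 1.10 (iii) p.30].  abc-iut cell, layer L2, seat abc-iut-w5-d062 (gen 3); sequel to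
`GalSectThm110iiiCuspPairTransport.lean` (p438817), whose binder `hΔ : Cα.augC.ker.map Γ = Cβ.augC.ker` is here DERIVED
from: (ΔX) the X-level transport of the geometric fundamental group `γ_X(Ker aug_α) = Ker aug_β` ([AbsAnab] Lem. 1.3.8 —
the same input as row L01 of the Thm. 1.6 sub-DAG), (nX) `Δ^tp_C ⊄ Π^tp_X` on both sides (`C = X/{±1}` has geometric
monodromy outside `X`; equivalently `aug_C` and `aug` have the same image), and (tf) the image of `aug` has NO ELEMENT
OF ORDER 2 (`G_K ⊆ G_{ℚ_p}` is torsion-free: absolute Galois groups of `p`-adic fields are torsion-free — Artin–Schreier;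
a classical fact, taken as a hypothesis on the data).  PROOF-ONLY: no definitions, no named facts.

* `Subgroup.eq_of_inf_index_two` — group theory: two NORMAL subgroups `N₁, N₂ ⊄ H` of a group with the same trace
  `W` on an index-`2` subgroup `H` coincide, provided `H/W` has no `2`-torsion (`h ∈ H, h² ∈ W ⇒ h ∈ W`);
* `MuTwoSetting.DotCCusp.ker_augC_inf_range` — `Ker aug_C ∩ Π^tp_X = Π^tp_X(Ker aug)`;
* **`MuTwoSetting.DotCCusp.augC_ker_map_eq`** — (Δ) from (ΔX) + (nX) + (tf).
HONEST FRAMING: inputs are printed/classical facts, none asserted; typed ≠ proved; no side taken on [IUTchIII] Cor. 3.12.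
-/

namespace Literature.AnabelianGeometry.EtaleTheta

open scoped Pointwise

section GroupTheory

variable {G : Type*} [Group G]

/-- **Two normal subgroups not inside an index-2 subgroup `H`, with the same trace `W` on `H`, are EQUAL when `H/W`
has no 2-torsion.** [cite: MochizukiEtTh2009, Thm 1.10 (iii) p.30] -/
theorem Subgroup.le_of_inf_index_two {H W N₁ N₂ : Subgroup G} [N₂.Normal] (hH : H.index = 2)
    (h₁ : N₁ ⊓ H = W) (h₂ : N₂ ⊓ H = W) (hn₂ : ¬ N₂ ≤ H)
    (htf : ∀ h ∈ H, h * h ∈ W → h ∈ W) : N₁ ≤ N₂ := by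
  obtain ⟨n, hnN, hnH⟩ := Set.not_subset.mp hn₂
  intro x hx
  by_cases hxH : x ∈ H
  · have : x ∈ N₂ ⊓ H := by rw [h₂, ← h₁]; exact ⟨hx, hxH⟩
    exact this.1
  · -- `h := x n⁻¹ ∈ H` and `h² ∈ N₂ ∩ H = W`
    have hnH' : n⁻¹ ∉ H := fun h => hnH (by simpa using H.inv_mem h)
    have hh : x * n⁻¹ ∈ H := (Subgroup.mul_mem_iff_of_index_two hH).2 (iff_of_false hxH hnH')
    have hx2W : x * x ∈ W := by
      rw [← h₁]; exact ⟨N₁.mul_mem hx hx, Subgroup.mul_self_mem_of_index_two hH x⟩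
    have hx2N : x * x ∈ N₂ := by
      have : x * x ∈ N₂ ⊓ H := by rw [h₂]; exact hx2W
      exact this.1
    have hsq : x * n⁻¹ * (x * n⁻¹) ∈ N₂ := by
      have e : x * n⁻¹ * (x * n⁻¹) = x * x * (x⁻¹ * n⁻¹ * x) * n⁻¹ := by group
      rw [e]
      refine N₂.mul_mem (N₂.mul_mem hx2N ?_) (N₂.inv_mem hnN)
      have := (inferInstance : N₂.Normal).conj_mem _ (N₂.inv_mem hnN) x⁻¹
      simpa using this
    have hsqW : x * n⁻¹ * (x * n⁻¹) ∈ W := by rw [← h₂]; exact ⟨hsq, H.mul_mem hh hh⟩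
    have hW : x * n⁻¹ ∈ W := htf _ hh hsqW
    have hWN : x * n⁻¹ ∈ N₂ := by
      have : x * n⁻¹ ∈ N₂ ⊓ H := by rw [h₂]; exact hW
      exact this.1
    simpa using N₂.mul_mem hWN hnN

/-- … and hence EQUAL when both are normal and neither lies in `H`. [cite: MochizukiEtTh2009, Thm 1.10 (iii) p.30] -/
theorem Subgroup.eq_of_inf_index_two {H W N₁ N₂ : Subgroup G} [N₁.Normal] [N₂.Normal] (hH : H.index = 2)
    (h₁ : N₁ ⊓ H = W) (h₂ : N₂ ⊓ H = W) (hn₁ : ¬ N₁ ≤ H) (hn₂ : ¬ N₂ ≤ H)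
    (htf : ∀ h ∈ H, h * h ∈ W → h ∈ W) : N₁ = N₂ :=
  le_antisymm (Subgroup.le_of_inf_index_two hH h₁ h₂ hn₂ htf) (Subgroup.le_of_inf_index_two hH h₂ h₁ hn₁ htf)

end GroupTheory

namespace MuTwoSetting

namespace DotCCusp

variable {p : ℕ} [Fact p.Prime] {Mα Mβ : MuTwoSetting p} {εα : Mα.GtpC} {εβ : Mβ.GtpC}
  {hCα : Mα.toThetaSetting.Compat} {hCβ : Mβ.toThetaSetting.Compat}
  {Eα : Mα.toThetaSetting.EtaleThetaData} {Eβ : Mβ.toThetaSetting.EtaleThetaData}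
  {γ : Mα.dotC εα ≃ₜ* Mβ.dotC εβ}

/-- `Ker aug_C ∩ Π^tp_X = Π^tp_X(Ker aug)` (since `aug_C ∘ inclX = aug`). [cite: MochizukiEtTh2009, Thm 1.10 (iii) p.30] -/
theorem ker_augC_inf_range {M : MuTwoSetting p} {εZ : M.GtpC} (C : M.DotCCusp εZ) :
    C.augC.ker ⊓ M.inclX.range = (M.aug.toMonoidHom.ker).map M.inclX := by
  ext g
  constructor
  · rintro ⟨hg, x, rfl⟩
    refine ⟨x, ?_, rfl⟩
    have : C.augC (M.inclX x) = 1 := hg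
    rw [C.augC_inclX] at this
    exact this
  · rintro ⟨x, hx, rfl⟩
    refine ⟨?_, x, rfl⟩
    change C.augC (M.inclX x) = 1
    rw [C.augC_inclX]
    exact hx

/-- **(Δ) from the X-level.**  If `γ_X` carries `Ker aug_α` onto `Ker aug_β` (ΔX), `Δ^tp_C ⊄ Π^tp_X` on both sides (nX),
and the image of `aug_β` has no element of order 2 (tf), then `Γ` carries `Ker aug_{Cα}` onto `Ker aug_{Cβ}` — the
binder `hΔ` of `hpair_of_cuspDecompTransport` / `thm110iiiGalSect_of_cuspDecompTransport`.
[cite: MochizukiEtTh2009, Thm 1.10 (iii) p.30] -/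
theorem augC_ker_map_eq (H : Thm110Hypothesis εα εβ hCα hCβ Eα Eβ γ) (Cα : Mα.DotCCusp εα) (Cβ : Mβ.DotCCusp εβ)
    (hΔX : (Mα.aug.toMonoidHom.ker).map H.γX.toMulEquiv.toMonoidHom = Mβ.aug.toMonoidHom.ker)
    (hnα : ¬ Cα.augC.ker ≤ Mα.inclX.range) (hnβ : ¬ Cβ.augC.ker ≤ Mβ.inclX.range)
    (htf : ∀ x : Mβ.PiTemp, Mβ.aug x * Mβ.aug x = 1 → Mβ.aug x = 1) :
    Cα.augC.ker.map H.Γ.toMulEquiv.toMonoidHom = Cβ.augC.ker := by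
  have hinj : Function.Injective H.Γ.toMulEquiv.toMonoidHom := H.Γ.toMulEquiv.injective
  haveI : (Cα.augC.ker.map H.Γ.toMulEquiv.toMonoidHom).Normal :=
    Subgroup.Normal.map inferInstance _ H.Γ.toMulEquiv.surjective
  refine Subgroup.eq_of_inf_index_two (H := Mβ.inclX.range) (W := Cβ.augC.ker ⊓ Mβ.inclX.range)
    Mβ.index_range_inclX ?_ rfl ?_ hnβ ?_
  · -- the traces on `Π^tp_X` agree, by (ΔX)
    rw [Cβ.ker_augC_inf_range]
    conv_lhs => rw [← H.preserves.map_X, ← Subgroup.map_inf _ _ _ hinj, Cα.ker_augC_inf_range,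
      map_Γ_map_inclX H, hΔX]
  · -- `Γ(Ker aug_{Cα}) ⊄ Π^tp_X`
    intro hle
    apply hnα
    intro g hg
    have : H.Γ.toMulEquiv.toMonoidHom g ∈ Mβ.inclX.range := hle ⟨g, hg, rfl⟩
    rw [← H.preserves.map_X] at this
    obtain ⟨g', hg', hgg'⟩ := this
    rw [← hinj hgg']
    exact hg'
  · -- no 2-torsion in `Π^tp_X / (Ker aug_C ∩ Π^tp_X) ≅ G_K`
    rintro _ ⟨x, rfl⟩ hsq
    refine ⟨?_, x, rfl⟩
    change Cβ.augC (Mβ.inclX x) = 1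
    rw [Cβ.augC_inclX]
    apply htf
    have h2 : Cβ.augC (Mβ.inclX x * Mβ.inclX x) = 1 := hsq.1
    rwa [map_mul, Cβ.augC_inclX] at h2

end DotCCusp

end MuTwoSetting

end Literature.AnabelianGeometry.EtaleTheta
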